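import Summits.ABC.IUTFork.Thm311LinkCompat
import Summits.ABC.IUTFork.Thm311Pilot
import Mathlib.CategoryTheory.Discrete.Basic
import HarnessLib

/-!
# [IUTchIII] Theorem 3.11 in the author's terms, E: vacuity audit of the typed statement

Record-only file (D-0012) of the abc-iut cell (seat abc-iut-c312-1); TAKES NO SIDE. The cell's rule for
fork-level hypothesis structures (HOME/README.md §RE-CHARTER: "vacuity-audit every fork-level hypothesis
(LANA Rem 8.2.1) with a non-vacuity witness as skel/ForkChecks does") applied to the typed Theorem 3.11
(`Thm311Sig`, `Thm311Multirad`, `Thm311LogKummer`, `Thm311LinkCompat`):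

1. CONSISTENCY (non-vacuity of the hypothesis): `toyFull` is a fully explicit `FullSituation` over a
   one-place index skeleton with `log(D⊢_v) = ℚ`, in which `FullSituation.Statement` — Theorem 3.11
   (i) ∧ (ii) ∧ (iii) as typed — HOLDS (`toyFull_statement`). So the typed Theorem 3.11 is not
   contradictory: assuming it (as Cor. 3.12 does) proves nothing by explosion.
2. CONTENT (non-tautology): `not_multiradialCompat_of_shellPk` — in ANY situation, if the integral
   structure of the line `n` at some `(j, v_ℚ)` is empty and that of the line `n'` is not, then (i)'s
   multiradial compatibility FAILS (the moves of (Ind1), (Ind2) transport integral structures by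
   bijections). Hence `exists_not_statement`: the typed Theorem 3.11 is refutable in some instantiation,
   i.e. it is a genuine constraint on the signature, not a tautology.
3. LEDGER of which clauses are automatic at this level (proved in the sequel files, recalled here by
   name): (iii)(a), (iii)(b) hold in EVERY instantiation (`LinkData.partIIIa_holds`, `partIIIb_holds` —
   squares of full poly-isomorphisms); the final clause of (ii) follows from (ii)(a)
   (`Column.logvolPrecise_of_kummerA`); the mutual compatibility of (ii) follows from (ii)(b),(c)
   (`Column.mutualCompat_of_kummerB_kummerC`); the "up to (Ind1), (Ind2), (Ind3)" clauses of (iii)(c),(d)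
   follow from (i) (`FullSituation.evalCompatUpToInd_of_multiradialCompat`). What carries content:
   `MultiradialCompat`, `DegreeClause`, `KummerA/B/C`, `Ind3`, `PartIIIc`, `PartIIId`
   (`FullSituation.statement_iff`).

The toy is a TOY: one valuation, trivial automorphisms, all log-volumes zero, no Frobenioid objects
beyond a point; it witnesses consistency of the typed sentences, nothing about IUT.
[claim: Mochizuki2012, status: disputed] [cite: LANA2026Report, Rem. 8.2.1 p. 42]
-/

noncomputable section

namespace Summit.ABC

namespace IUTFork

namespace Thm311

open CategoryTheory

open Literature.IUT.HodgeTheaters (PolyIso)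

/-! ## 1. Content: (i) is refutable -/

/-- Emptiness of an integral structure `I(^{S^±_{j+1}};D⊢_{v_ℚ})` is invariant under every indeterminacy move
(images of `∅` are `∅`, images of nonempty sets are nonempty). [folklore] -/
theorem shellPk_empty_invariant {T : ThetaIndex} {L : LogShells T} (j : T.Label) (vQ : T.VQ)
    (D D' : MRData L) (h : MRData.IndMoves D D') : D.shellPk j vQ = ∅ ↔ D'.shellPk j vQ = ∅ := by
  obtain ⟨Φ, -, rfl⟩ := h
  simp only [MRData.map, Set.image_eq_empty]

/-- **(i) is not a tautology.** If in a situation the integral structure of the line `n` at `(j, v_ℚ)` is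
empty while that of the line `n'` is nonempty, the multiradial compatibility `^{n,∘}R^{LGP} = ^{n',∘}R^{LGP}`
fails. [folklore] -/
theorem not_multiradialCompat_of_shellPk {T : ThetaIndex} (S : Situation T) (n n' : ℤ) (j : T.Label)
    (vQ : T.VQ) (h0 : (S.D n).shellPk j vQ = ∅) (h1 : (S.D n').shellPk j vQ ≠ ∅) :
    ¬ S.MultiradialCompat := by
  intro h
  have := (S.invariant_iff_of_multiradialCompat h (P := fun D => D.shellPk j vQ = ∅)
    (fun D D' hm => shellPk_empty_invariant j vQ D D' hm) n n').1 h0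
  exact h1 this

/-! ## 2. The toy instantiation -/

/-- One valuation over one place, `l⋇ = 2` (`l = 5`), everything nonarchimedean. [folklore] -/
def toyIndex : ThetaIndex where
  lstar := 2
  two_le_lstar := le_rfl
  V := Unit
  VQ := Unit
  over := id
  IsNon := fun _ => True
  fibre_finite := fun _ => Set.toFinite _
  fibre_nonempty := fun _ => ⟨(), rfl⟩
  Vbad := Set.univ
  Vbad_nonempty := ⟨(), trivial⟩
  Vbad_finite := Set.toFinite _
  Vbad_non := fun _ _ => trivial

/-- `log(D⊢_v) := ℚ`, the log-shell all of it, only the identity acting. [folklore] -/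
def toyShells : LogShells toyIndex where
  carrier := fun _ => ℚ
  shell := fun _ => Set.univ
  stripAut := fun _ => {LinearEquiv.refl ℚ ℚ}
  ism := fun _ => {LinearEquiv.refl ℚ ℚ}
  one_mem_stripAut := fun _ => rfl
  one_mem_ism := fun _ => rfl

/-- Data (a)(b)(c) with everything full/empty and all log-volumes zero. [folklore] -/
def toyData : MRData toyShells where
  shellPk := fun _ _ => Set.univ
  shellSub := fun _ _ => Set.univ
  Adm := fun _ _ _ => True
  logvol := fun _ _ _ => 0
  Ψ := fun _ _ => ∅
  act := fun _ _ _ => 0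
  Mmod := fun _ => ∅

/-- A data with EMPTY integral structures (to refute (i) against `toyData`). [folklore] -/
def toyDataEmpty : MRData toyShells where
  shellPk := fun _ _ => ∅
  shellSub := fun _ _ => ∅
  Adm := fun _ _ _ => True
  logvol := fun _ _ _ => 0
  Ψ := fun _ _ => ∅
  act := fun _ _ _ => 0
  Mmod := fun _ => ∅

/-- One Frobenioid object of degree `0` whose region is everything. [folklore] -/
def toyDegrees (j : toyIndex.LabelStar) : GlobalDegrees toyShells j where
  ObjMOD := Unit
  Objmod := Unit
  natIso := Equiv.refl Unit
  deg := fun _ => 0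
  region := fun _ _ => Set.univ

/-- The toy situation: the same data on every vertical line. [folklore] -/
def toySituation : Situation toyIndex where
  L := toyShells
  D := fun _ => toyData
  G := fun _ j => toyDegrees j

/-- The bad situation: empty integral structures on the line `0`, full ones elsewhere. [folklore] -/
def toyBadSituation : Situation toyIndex where
  L := toyShells
  D := fun n => if n = 0 then toyDataEmpty else toyData
  G := fun _ j => toyDegrees j

/-- A column whose transported data coincide with `toyData` and whose unit images are everything.
[folklore] -/
def toyColumn : Column toyShells where
  frobAdm := fun _ _ _ _ => True
  frobLogvol := fun _ _ _ _ => 0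
  frobΨ := fun _ _ _ => ∅
  frobMmod := fun _ _ => ∅
  unitImage := fun _ _ _ _ => Set.univ
  ballImage := fun _ _ _ => Set.univ
  ObjLGP := Unit
  frobObjLGP := fun _ => Unit
  kumLGP := fun _ => Equiv.refl Unit
  ObjLgp := Unit
  frobObjLgp := fun _ => Unit
  kumLgp := fun _ => Equiv.refl Unit
  thetaPilot := fun _ => ()

/-- Link data over the one-object discrete category: every poly-isomorphism full, every induced
automorphism the identity. [folklore] -/
def toyLink : LinkData where
  Strip := Discrete PUnit
  Fdelta := fun _ _ => ⟨⟨⟩⟩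
  FdeltaD := fun _ => ⟨⟨⟩⟩
  kumDelta := fun _ _ => Iso.refl _
  FenvD := fun _ => ⟨⟨⟩⟩
  natEnvD := fun _ => Iso.refl _
  Rad := Discrete PUnit
  R := fun _ => ⟨⟨⟩⟩
  permR := fun _ => PolyIso.full _ _
  Kap := Discrete PUnit
  Mk := fun _ => ⟨⟨⟩⟩
  permM := fun _ => PolyIso.full _ _
  AutHT := fun _ _ => Unit
  onDelta := fun _ _ _ => Iso.refl _
  onDeltaD := fun _ _ _ => Iso.refl _
  onR := fun _ _ _ => Iso.refl _
  onM := fun _ _ _ => Iso.refl _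

/-- The full toy situation. [folklore] -/
def toyFull : FullSituation toyIndex where
  toSituation := toySituation
  col := fun _ => toyColumn
  link := toyLink

/-! ## 3. Consistency: the typed Theorem 3.11 holds in the toy -/

/-- (i) holds in the toy. [folklore] -/
theorem toy_partI : toyFull.PartI := by
  refine ⟨fun n v hv x hx => ?_, fun n j J => ⟨fun _ => trivial, ?_, ?_⟩, fun n n' => rfl⟩
  · exact absurd hx (Set.notMem_empty x)
  · haveI : Finite toyIndex.VQ := inferInstanceAs (Finite Unit)
    exact Set.toFinite _
  · change (0 : ℝ) = ∑ᶠ _ : Unit, (0 : ℝ)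
    exact (finsum_eq_zero_of_forall_eq_zero fun _ => rfl).symm

/-- (ii) holds in the toy, column by column. [folklore] -/
theorem toy_partII : toyFull.toLatticeSituation.PartII := by
  intro n
  refine (Column.partII_iff _ _).2 ⟨?_, fun _ _ _ => rfl, fun _ _ => rfl, ?_⟩
  · intro m j vQ A _; exact ⟨trivial, rfl⟩
  · refine ⟨fun m m' j vQ _ => Set.subset_univ _, fun m j vQ h => absurd trivial h⟩

/-- (iii) holds in the toy. [folklore] -/
theorem toy_partIII : toyFull.PartIII := by
  refine ⟨toyLink.partIIIa_holds, toyLink.partIIIb_holds, ?_, ?_,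
    toyFull.evalCompatUpToInd_of_multiradialCompat toy_partI.2.2⟩
  · refine toyLink.partIIIc_of_full (fun _ => rfl) fun n m => ?_
    rintro p ⟨a, rfl⟩; rfl
  · intro n m; exact PolyIsoCalc.stabilized_full _ _

/-- **Non-vacuity witness**: Theorem 3.11 (i) ∧ (ii) ∧ (iii), as typed, holds in the toy instantiation —
the typed hypothesis is consistent. [folklore] -/
theorem toyFull_statement : toyFull.Statement := ⟨toy_partI, toy_partII, toy_partIII⟩

/-- ∃-form of the non-vacuity witness. [folklore] -/
theorem exists_statement : ∃ (T : ThetaIndex) (S : FullSituation T), S.Statement :=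
  ⟨toyIndex, toyFull, toyFull_statement⟩

/-- The group-level log-volume invariance hypothesis of `Thm311Pilot` (`LogvolIndInvariant`: every
indeterminacy generated by (Ind1), (Ind2) preserves admissibility and log-volume) is consistent with the
typed Theorem 3.11: it holds in the toy (all regions admissible, all log-volumes zero). [folklore] -/
theorem toy_logvolIndInvariant (n : ℤ) (j : toyIndex.LabelStar) (vQ : toyIndex.VQ) :
    toyFull.toLatticeSituation.LogvolIndInvariant n j vQ :=
  fun _ _ _ _ => ⟨trivial, rfl⟩

/-! ## 4. Content: the typed Theorem 3.11 fails somewhere -/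

/-- In the bad situation (i) fails: the line-`0` integral structure is empty, the line-`1` one contains
`0`. [folklore] -/
theorem toyBad_not_multiradialCompat : ¬ toyBadSituation.MultiradialCompat :=
  not_multiradialCompat_of_shellPk toyBadSituation 0 1 0 () (by rfl)
    (by
      change (toyData.shellPk 0 ()) ≠ ∅
      exact Set.nonempty_iff_ne_empty.mp ⟨0, trivial⟩)

/-- **Non-tautology witness**: there is an instantiation of the full situation in which Theorem 3.11, as
typed, FAILS (already its part (i)). [folklore] -/
theorem exists_not_statement : ∃ (T : ThetaIndex) (S : FullSituation T), ¬ S.Statement :=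
  ⟨toyIndex, { toSituation := toyBadSituation, col := fun _ => toyColumn, link := toyLink },
    fun h => toyBad_not_multiradialCompat h.1.2.2⟩

end Thm311

end IUTFork

end Summit.ABC

end
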